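import Summits.NavierStokesRegularity.NavierStokesRegularity.Theorems.RellichScarSymmetricScarExistsScarStabiliserDichotomy

/-!
# Crux `SymmetricScarExists` (stmt-NavierStokesRegularity-11718), line `rdss-screw-split` — the split refined by the
# scar-stabiliser dichotomy (lead c4)

Support file of the line lead (`--supports stmt-NavierStokesRegularity-11718`; registered by-products
`symmetricScarExistsSpiral_of_selection_isolatedWall`, `symmetricScarExists_of_selection_isolatedWall_spiralFatal`).
Where exactly the RDSS Liouville wall (children B ∧ C of the split `S ⇐ A ∧ B ∧ C`) is needed: apply the dichotomy
`scarStabiliser_dichotomy` to the witness of child A.  If the identity is NOT isolated among its scar-fixing screws, the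
scar is spiral/homogeneous/axisymmetric and the repaired crux `SymmetricScarExistsSpiral` holds with no wall at all; so
B ∧ C are consumed only through the ISOLATED WALL "no singular apex profile has a scar fixed by a screw `(c, θ)`, `c > 1`,
which is an isolated point of its scar stabiliser" (`symmetricScarExistsSpiral_of_selection_isolatedWall`).  For the crux
itself one needs in addition the fatality of SPIRAL scars of non-zero pitch (B along a one-parameter subgroup + the rotated
self-similar Liouville theorems, Pineau–Vicol 2026 Conj. 1.1), since `SpiralScar 0 = HomScar`
(`symmetricScarExists_of_selection_isolatedWall_spiralFatal`).

## References

* B. Pineau, V. Vicol (2026), arXiv:2607.09619, Conj. 1.1, Rem. 1.5. [PineauVicol2026]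
-/

noncomputable section

open MeasureTheory Set Function Filter Topology TopologicalSpace Metric
open scoped NNReal ENNReal

namespace Summit.NavierStokesRegularity.NavierStokesRegularity.Theorems.SymmetricScarExists.RdssSplit.ScarLevel

set_option linter.dupNamespace false

open Literature.Analysis.FluidPDE
open Summit.NavierStokesRegularity.NavierStokesRegularity.Theses.RellichScar
open Summit.NavierStokesRegularity.NavierStokesRegularity.Theorems.SymmetricScarExists.Negative


/-- Positivity of the constant of a singular apex profile. [folklore] -/
theorem apexConstant_pos_of_singular {u : ℝ → EuclideanSpace ℝ (Fin 3) → EuclideanSpace ℝ (Fin 3)} {C : ℝ}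
    (hdec : HasTypeIDecay C u) (hsing : IsBackwardSingularPoint u 0) : 0 < C := by
  by_contra hle
  push Not at hle
  refine Summit.NavierStokesRegularity.NavierStokesRegularity.Theorems.SymmetricScarExists.ScarWindow.not_isBackwardSingularPoint_of_ae_zero_slab (u := u) ?_ hsing
  filter_upwards [ae_restrict_mem (measurableSet_Iio.prod MeasurableSet.univ)] with w hw
  exact Summit.NavierStokesRegularity.NavierStokesRegularity.Theorems.SymmetricScarExists.ScarWindow.eq_zero_of_hasTypeIDecay_nonpos hle hdec hw.1 w.2

/-- **The RDSS split refined by the dichotomy, crux form.**  With, in addition, the fatality of SPIRAL scars of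
non-zero pitch (children B along a one-parameter subgroup + the rotated self-similar Liouville theorems
`RssApexFatal α`, `α ≠ 0`), the crux `SymmetricScarExists` itself follows (`SpiralScar 0 = HomScar`). [folklore] -/
theorem symmetricScarExists_of_selection_isolatedWall_spiralFatal :
    (∀ C : ℝ, (∃ (u : ℝ → EuclideanSpace ℝ (Fin 3) → EuclideanSpace ℝ (Fin 3)) (p : ℝ → EuclideanSpace ℝ (Fin 3) → ℝ) (G : ℝ → EuclideanSpace ℝ (Fin 3) → EuclideanSpace ℝ (Fin 3) →L[ℝ] EuclideanSpace ℝ (Fin 3)), Literature.Analysis.FluidPDE.IsSuitableWeakSolutionOn (Literature.Analysis.FluidPDE.slab (EuclideanSpace ℝ (Fin 3)) (Set.Iio 0) isOpen_Iio) 1 0 u p ∧ Literature.Analysis.FluidPDE.HasWeakSpatialGradientOn (Literature.Analysis.FluidPDE.slab (EuclideanSpace ℝ (Fin 3)) (Set.Iio 0) isOpen_Iio) u G ∧ Literature.Analysis.FluidPDE.typeIBound (Set.Iio (0 : ℝ) ×ˢ Set.univ) u p G < ⊤ ∧ Literature.Analysis.FluidPDE.HasTypeIDecay C u ∧ Literature.Analysis.FluidPDE.IsBackwardSingularPoint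 u 0) → ∃ (C' : ℝ) (u : ℝ → EuclideanSpace ℝ (Fin 3) → EuclideanSpace ℝ (Fin 3)) (p : ℝ → EuclideanSpace ℝ (Fin 3) → ℝ) (G : ℝ → EuclideanSpace ℝ (Fin 3) → EuclideanSpace ℝ (Fin 3) →L[ℝ] EuclideanSpace ℝ (Fin 3)), Literature.Analysis.FluidPDE.IsSuitableWeakSolutionOn (Literature.Analysis.FluidPDE.slab (EuclideanSpace ℝ (Fin 3)) (Set.Iio 0) isOpen_Iio) 1 0 u p ∧ Literature.Analysis.FluidPDE.HasWeakSpatialGradientOn (Literature.Analysis.FluidPDE.slab (EuclideanSpace ℝ (Fin 3)) (Set.Iio 0) isOpen_Iio) u G ∧ Literature.Analysis.FluidPDE.typeIBound (Set.Iio (0 : ℝ) ×ˢ Set.univ) u p G < ⊤ ∧ Literature.Analysis.FluidPDE.HasTypeIDecay C' u ∧ Literature.Analysis.FluidPDE.IsBackwardSingularPoint u 0 ∧ ((∃ c θ : ℝ, 1 < c ∧ ∀ K : Set (EuclideanSpace ℝ (Fin 3)), IsCompact K → (0 : EuclideanSpace ℝ (Fin 3)) ∉ K → Filter.Tendsto (fun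 δ : ℝ => MeasureTheory.eLpNorm (Function.uncurry (fun t x => Literature.Analysis.FluidPDE.rotZ θ (Literature.Analysis.FluidPDE.nsRescale c u t (Literature.Analysis.FluidPDE.rotZ (-θ) x))) - Function.uncurry u) ⊤ (MeasureTheory.volume.restrict (Set.Ioo (-δ) 0 ×ˢ K))) (nhdsWithin 0 (Set.Ioi 0)) (nhds 0)) ∨ (∀ θ : ℝ, ∀ K : Set (EuclideanSpace ℝ (Fin 3)), IsCompact K → (0 : EuclideanSpace ℝ (Fin 3)) ∉ K → Filter.Tendsto (fun δ : ℝ => MeasureTheory.eLpNorm (Function.uncurry (fun t x => Literature.Analysis.FluidPDE.rotZ θ (u t (Literature.Analysis.FluidPDE.rotZ (-θ) x))) - Function.uncurry u) ⊤ (MeasureTheory.volume.restrict (Set.Ioo (-δ) 0 ×ˢ K))) (nhdsWithin 0 (Set.Ioi 0)) (nhds 0)))) → (∀ (u : ℝ → EuclideanSpace ℝ (Fin 3) → EuclideanSpace ℝ (Fin 3)) (p : ℝ → EuclideanSpace ℝ (Fin 3) → ℝ) (G : ℝ → EuclideanSpace ℝ (Fin 3) → EuclideanSpace ℝ (Fin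 3) →L[ℝ] EuclideanSpace ℝ (Fin 3)) (C c θ : ℝ), Literature.Analysis.FluidPDE.IsSuitableWeakSolutionOn (Literature.Analysis.FluidPDE.slab (EuclideanSpace ℝ (Fin 3)) (Set.Iio 0) isOpen_Iio) 1 0 u p → Literature.Analysis.FluidPDE.HasWeakSpatialGradientOn (Literature.Analysis.FluidPDE.slab (EuclideanSpace ℝ (Fin 3)) (Set.Iio 0) isOpen_Iio) u G → Literature.Analysis.FluidPDE.typeIBound (Set.Iio (0 : ℝ) ×ˢ Set.univ) u p G < ⊤ → Literature.Analysis.FluidPDE.HasTypeIDecay C u → Literature.Analysis.FluidPDE.IsBackwardSingularPoint u 0 → 1 < c → Summit.NavierStokesRegularity.NavierStokesRegularity.Theorems.SymmetricScarExists.Negative.SameScar (Summit.NavierStokesRegularity.NavierStokesRegularity.Theorems.SymmetricScarExists.Negative.conjZ θ (Literature.Analysis.FluidPDE.nsRescale c u)) u → (∃ ε : ℝ, 0 < ε ∧ ∀ a φ : ℝ, Summit.NavierStokesRegularity.NavierStokesRegularity.Theorems.SymmetricScarExists.Negative.SameScar (Summit.NavierStokesRegularity.NavierStokesRegularity.Theorems.SymmetricScarExists.Negative.conjZ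 φ (Literature.Analysis.FluidPDE.nsRescale (Real.exp a) u)) u → (a, φ) ≠ (0, 0) → ε ≤ ‖(a, φ)‖) → False) → (∀ α : ℝ, α ≠ 0 → ∀ (u : ℝ → EuclideanSpace ℝ (Fin 3) → EuclideanSpace ℝ (Fin 3)) (p : ℝ → EuclideanSpace ℝ (Fin 3) → ℝ) (G : ℝ → EuclideanSpace ℝ (Fin 3) → EuclideanSpace ℝ (Fin 3) →L[ℝ] EuclideanSpace ℝ (Fin 3)) (C : ℝ), Literature.Analysis.FluidPDE.IsSuitableWeakSolutionOn (Literature.Analysis.FluidPDE.slab (EuclideanSpace ℝ (Fin 3)) (Set.Iio 0) isOpen_Iio) 1 0 u p → Literature.Analysis.FluidPDE.HasWeakSpatialGradientOn (Literature.Analysis.FluidPDE.slab (EuclideanSpace ℝ (Fin 3)) (Set.Iio 0) isOpen_Iio) u G → Literature.Analysis.FluidPDE.typeIBound (Set.Iio (0 : ℝ) ×ˢ Set.univ) u p G < ⊤ → Literature.Analysis.FluidPDE.HasTypeIDecay C u → Literature.Analysis.FluidPDE.IsBackwardSingularPoint u 0 → Summit.NavierStokesRegularity.NavierStokesRegularity.Theorems.SymmetricScarExists.Negative.SpiralScar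 α u → False) → Summit.NavierStokesRegularity.NavierStokesRegularity.Theses.RellichScar.SymmetricScarExists := by
  intro hA hW hSp C hex
  obtain ⟨C', u, p, G, hsw, hwg, hI, hdec, hsing, hsel⟩ := hA C hex
  have hC' : 0 < C' := apexConstant_pos_of_singular hdec hsing
  refine ⟨C', u, p, G, hsw, hwg, hI, hdec, hsing, ?_⟩
  rcases hsel with ⟨c, θ, hc, hscar⟩ | hax
  · rcases scarStabiliser_dichotomy u p G C' hC' hsw hwg hI hdec with hiso | ⟨α, hα⟩ | hax'
    · exact (hW u p G C' c θ hsw hwg hI hdec hsing hc hscar hiso).elim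
    · by_cases h0 : α = 0
      · subst h0
        exact Or.inl (spiralScar_zero_iff.1 hα)
      · exact (hSp α h0 u p G C' hsw hwg hI hdec hsing hα).elim
    · exact Or.inr hax'
  · exact Or.inr hax

/-- **The RDSS split refined by the dichotomy, repaired-crux form.**  Child A (a singular apex profile whose scar is
fixed by ONE screw `(c, θ)`, `c > 1`, or is axisymmetric) together with the ISOLATED WALL — "no singular apex profile
has a scar fixed by a screw `(c, θ)`, `c > 1`, which is an isolated point of its scar stabiliser" (children B ∧ C are
needed only there) — already gives the repaired crux `SymmetricScarExistsSpiral`: if the identity is not isolated in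
the stabiliser of A's witness, the dichotomy supplies the spiral/axisymmetric scar directly. [folklore] -/
theorem symmetricScarExistsSpiral_of_selection_isolatedWall :
    (∀ C : ℝ, (∃ (u : ℝ → EuclideanSpace ℝ (Fin 3) → EuclideanSpace ℝ (Fin 3)) (p : ℝ → EuclideanSpace ℝ (Fin 3) → ℝ) (G : ℝ → EuclideanSpace ℝ (Fin 3) → EuclideanSpace ℝ (Fin 3) →L[ℝ] EuclideanSpace ℝ (Fin 3)), Literature.Analysis.FluidPDE.IsSuitableWeakSolutionOn (Literature.Analysis.FluidPDE.slab (EuclideanSpace ℝ (Fin 3)) (Set.Iio 0) isOpen_Iio) 1 0 u p ∧ Literature.Analysis.FluidPDE.HasWeakSpatialGradientOn (Literature.Analysis.FluidPDE.slab (EuclideanSpace ℝ (Fin 3)) (Set.Iio 0) isOpen_Iio) u G ∧ Literature.Analysis.FluidPDE.typeIBound (Set.Iio (0 : ℝ) ×ˢ Set.univ) u p G < ⊤ ∧ Literature.Analysis.FluidPDE.HasTypeIDecay C u ∧ Literature.Analysis.FluidPDE.IsBackwardSingularPoint u 0) → ∃ (C' : ℝ) (u : ℝ → EuclideanSpace ℝ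 (Fin 3) → EuclideanSpace ℝ (Fin 3)) (p : ℝ → EuclideanSpace ℝ (Fin 3) → ℝ) (G : ℝ → EuclideanSpace ℝ (Fin 3) → EuclideanSpace ℝ (Fin 3) →L[ℝ] EuclideanSpace ℝ (Fin 3)), Literature.Analysis.FluidPDE.IsSuitableWeakSolutionOn (Literature.Analysis.FluidPDE.slab (EuclideanSpace ℝ (Fin 3)) (Set.Iio 0) isOpen_Iio) 1 0 u p ∧ Literature.Analysis.FluidPDE.HasWeakSpatialGradientOn (Literature.Analysis.FluidPDE.slab (EuclideanSpace ℝ (Fin 3)) (Set.Iio 0) isOpen_Iio) u G ∧ Literature.Analysis.FluidPDE.typeIBound (Set.Iio (0 : ℝ) ×ˢ Set.univ) u p G < ⊤ ∧ Literature.Analysis.FluidPDE.HasTypeIDecay C' u ∧ Literature.Analysis.FluidPDE.IsBackwardSingularPoint u 0 ∧ ((∃ c θ : ℝ, 1 < c ∧ ∀ K : Set (EuclideanSpace ℝ (Fin 3)), IsCompact K → (0 : EuclideanSpace ℝ (Fin 3)) ∉ K → Filter.Tendsto (fun δ : ℝ => MeasureTheory.eLpNorm (Function.uncurry (fun t x =>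 Literature.Analysis.FluidPDE.rotZ θ (Literature.Analysis.FluidPDE.nsRescale c u t (Literature.Analysis.FluidPDE.rotZ (-θ) x))) - Function.uncurry u) ⊤ (MeasureTheory.volume.restrict (Set.Ioo (-δ) 0 ×ˢ K))) (nhdsWithin 0 (Set.Ioi 0)) (nhds 0)) ∨ (∀ θ : ℝ, ∀ K : Set (EuclideanSpace ℝ (Fin 3)), IsCompact K → (0 : EuclideanSpace ℝ (Fin 3)) ∉ K → Filter.Tendsto (fun δ : ℝ => MeasureTheory.eLpNorm (Function.uncurry (fun t x => Literature.Analysis.FluidPDE.rotZ θ (u t (Literature.Analysis.FluidPDE.rotZ (-θ) x))) - Function.uncurry u) ⊤ (MeasureTheory.volume.restrict (Set.Ioo (-δ) 0 ×ˢ K))) (nhdsWithin 0 (Set.Ioi 0)) (nhds 0)))) → (∀ (u : ℝ → EuclideanSpace ℝ (Fin 3) → EuclideanSpace ℝ (Fin 3)) (p : ℝ → EuclideanSpace ℝ (Fin 3) → ℝ) (G : ℝ → EuclideanSpace ℝ (Fin 3) → EuclideanSpace ℝ (Fin 3) →L[ℝ] EuclideanSpace ℝ (Fin 3)) (C c θ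 : ℝ), Literature.Analysis.FluidPDE.IsSuitableWeakSolutionOn (Literature.Analysis.FluidPDE.slab (EuclideanSpace ℝ (Fin 3)) (Set.Iio 0) isOpen_Iio) 1 0 u p → Literature.Analysis.FluidPDE.HasWeakSpatialGradientOn (Literature.Analysis.FluidPDE.slab (EuclideanSpace ℝ (Fin 3)) (Set.Iio 0) isOpen_Iio) u G → Literature.Analysis.FluidPDE.typeIBound (Set.Iio (0 : ℝ) ×ˢ Set.univ) u p G < ⊤ → Literature.Analysis.FluidPDE.HasTypeIDecay C u → Literature.Analysis.FluidPDE.IsBackwardSingularPoint u 0 → 1 < c → Summit.NavierStokesRegularity.NavierStokesRegularity.Theorems.SymmetricScarExists.Negative.SameScar (Summit.NavierStokesRegularity.NavierStokesRegularity.Theorems.SymmetricScarExists.Negative.conjZ θ (Literature.Analysis.FluidPDE.nsRescale c u)) u → (∃ ε : ℝ, 0 < ε ∧ ∀ a φ : ℝ, Summit.NavierStokesRegularity.NavierStokesRegularity.Theorems.SymmetricScarExists.Negative.SameScar (Summit.NavierStokesRegularity.NavierStokesRegularity.Theorems.SymmetricScarExists.Negative.conjZ φ (Literature.Analysis.FluidPDE.nsRescale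 (Real.exp a) u)) u → (a, φ) ≠ (0, 0) → ε ≤ ‖(a, φ)‖) → False) → Summit.NavierStokesRegularity.NavierStokesRegularity.Theorems.SymmetricScarExists.Negative.SymmetricScarExistsSpiral := by
  intro hA hW C hex
  obtain ⟨C', u, p, G, hsw, hwg, hI, hdec, hsing, hsel⟩ := hA C hex
  have hC' : 0 < C' := apexConstant_pos_of_singular hdec hsing
  refine ⟨C', u, p, G, hsw, hwg, hI, hdec, hsing, ?_⟩
  rcases hsel with ⟨c, θ, hc, hscar⟩ | hax
  · rcases scarStabiliser_dichotomy u p G C' hC' hsw hwg hI hdec with hiso | h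
    · exact (hW u p G C' c θ hsw hwg hI hdec hsing hc hscar hiso).elim
    · exact h
  · exact Or.inr hax

end Summit.NavierStokesRegularity.NavierStokesRegularity.Theorems.SymmetricScarExists.RdssSplit.ScarLevel

end
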